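import Summits.ResolutionOfSingularities.ResolutionOfSingularities.Theses.WeightedInvariant
import Summits.ResolutionOfSingularities.ResolutionOfSingularities.Theorems.WeightedInvariantDescentReducedToIntegral
import Literature.AlgebraicGeometry.Resolution.FBlowup
import Literature.AlgebraicGeometry.Resolution.KunzRegularityCriterion
import Literature.AlgebraicGeometry.Resolution.LipmanProcedure
import Literature.AlgebraicGeometry.Resolution.SurfaceResolutionReduction
import Literature.AlgebraicGeometry.Resolution.QuasiProjectiveResolution
import Literature.AlgebraicGeometry.Resolution.BlowupsFlatBaseChange
import Summits.ResolutionOfSingularities.ResolutionOfSingularities.Theorems.WeightedInvariantWeightedThesisFBlowupExists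
import Summits.ResolutionOfSingularities.ResolutionOfSingularities.Theorems.WeightedInvariantWeightedThesisTowerExists
import Summits.ResolutionOfSingularities.ResolutionOfSingularities.Theorems.WeightedInvariantWeightedThesisKunzFlat
import Summits.ResolutionOfSingularities.ResolutionOfSingularities.Theorems.WeightedInvariantWeightedThesisKunzIso
import Summits.ResolutionOfSingularities.ResolutionOfSingularities.Theorems.WeightedInvariantWeightedThesisNormalizationIso
import Summits.ResolutionOfSingularities.ResolutionOfSingularities.Theorems.WeightedInvariantWeightedThesisLocalToGlobal
import Summits.ResolutionOfSingularities.ResolutionOfSingularities.Theorems.WeightedInvariantWeightedThesisKunzTowerTransfer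
import Summits.ResolutionOfSingularities.ResolutionOfSingularities.Theorems.WeightedInvariantWeightedThesisStageZeroDimLeOne

/-!
# Crux `WeightedThesis` (stmt-ResolutionOfSingularities-0569) — line `kunz-tower-exceptional-defect`

LEAD SKELETON (prover-line-stmt-ResolutionOfSingularities-0569-c1-0 cycle 1; c2-0 cycle 2; c3-0 cycle 3, 2026-08-16/17), rebuilt on
TREE VOCABULARY (the planner's evidence skeleton posited in-file bundles `FBlowup k` /
`IntegralVariety k`; since then `Literature.AlgebraicGeometry.Resolution.IsFBlowup` (FBlowup.lean),
`FrobeniusNormIdeal.lean` and the named fact `Kunz1969` have landed, so nothing is posited here).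

STATE (2026-08-17, lead c3): LINE DEAD — stub 7b below is FALSE (toric sixfold counterexample, see its
docstring). Earlier state (2026-08-16T13:45Z): the TRANSFER `stub_weightedThesis_of_pointwiseTermination` (stub 8:
termination ⇒ crux) LANDED as p105990; after wave 1 (11:40Z) stubs 1–6 LANDED as Theorems files (p99705 F-blowup
existence by gluing; p98038 towers; p98820 Kunz's theorem "regular ⇒ Frobenius flat", PROVED
unconditionally by Matsumura-23.1 slicing; p100239 F-blowups are isomorphisms over the regular
locus; p97893 normalisation iso over regular opens; p97848 local-to-global) and are discharged below
by name; the ONLY remaining `sorry` is stub 7 `stub_pointwiseTermination` = the normalised form of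
Yasuda 2012 Question 1.4 (open problem; the lead's). So: `WeightedThesis` is PROVED MODULO
"the normalised F-blowup tower of every variety over a perfect field is eventually regular over
each closed point" — a second, datum-free derivation of the route's target.

THE LINE. One canonical operation and no invariant: `Y ↦ FB_e(Y)^ν`, the normalisation of the
`e`-th F-blowup (Yasuda 2012 = arXiv:0706.2700, Def. 2.2 / Cor. 2.6; blow-up form Villamayor 2006
Thm. 3.3: blow up the Frobenius norm ideal `[[F^e_* 𝒪]]`), iterated. For an integral `X₀` of finite
type over a PERFECT field of characteristic `p` (perfect ⇒ F-finite ⇒ the norm ideal is a nonzero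
coherent ideal, FrobeniusNormIdeal.lean) a NORMALISED F-BLOWUP TOWER OF LEVEL `e` OVER `X₀` is
unbundled data `X : ℕ → Scheme`, `ρ n : X n ⟶ X₀`, `π n : X (n+1) ⟶ X n` with `π n ≫ ρ n = ρ (n+1)`,
where `ρ 0` and every `π n` is (an isomorphism followed by) the normalisation of an `e`-th F-blowup.
Stubs:
* `stub_fblowupExists` — every integral separated `k`-scheme of finite type has an `e`-th F-blowup
  (gluing of the affine blow-ups `Bl_{[[F^e_*A]]} Spec A`, Villamayor 3.4; FBlowup.lean "NOT here").
* `stub_towerExists` — hence normalised F-blowup towers of every level exist over it (recursion +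
  normalisation; the F-blowup of a variety is a variety).
  (with bookkeeping: every `ρ n` proper and birational).
* `stub_kunzFlat` — the named fact `Kunz1969` in the direction used: Frobenius of a regular local
  ring of characteristic `p` is flat (the line is CONDITIONAL on it until proved).
* `stub_kunzIso` — an `e`-th F-blowup is an isomorphism over the regular locus (Yasuda Prop. 2.7 /
  Cor. 2.6: regular ⇒ Frobenius flat (named fact `Kunz1969`) ⇒ `F^e_*𝒪` locally free ⇒ the norm
  ideal is invertible ⇒ its blow-up is an isomorphism), from stub 3 as hypothesis.
* `stub_normalizationIso` — the normalisation of an integral `k`-scheme of finite type is an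
  isomorphism over every open contained in the regular locus (regular ⇒ normal).
* `stub_localToGlobal` — for a tower whose maps are proper and isomorphisms over regular loci:
  if over every CLOSED point of `X₀` some stage is regular, then some stage `X n` is regular
  (openness of `Reg` for schemes locally of finite type over a field, closed images, Jacobson,
  quasi-compactness).
* `stub_pointwiseTermination` — THE OPEN STUB (normalised form of Yasuda 2012, Question 1.4; the
  lead's own): for every integral separated `X₀` of finite type over a perfect field of
  characteristic `p` there is a level `e ≥ 1` such that every normalised F-blowup tower of level `e`
  over `X₀` becomes regular over each closed point of `X₀` at some stage.
Composition `WeightedThesis_of`: integral case by the stubs (some `X n` is regular, `ρ n` is proper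
birational ⇒ `HasResolution X₀`), reduced case by the landed `DescentReducedToIntegral`
(`descentReducedToIntegral_proof`, stmt-0551).

Disproof.lean (v1.2) honoured: `[PerfectField k]` is consumed (F-finiteness: existence of the norm
ideal / of F-blowups, stub 1), `IsReduced`/`LocallyOfFiniteType` are used (reduction to integral;
Noether normalisation finiteness; openness of `Reg`), the content sits in the minimal case §3.
-/

noncomputable section

set_option linter.dupNamespace false

open CategoryTheory CategoryTheory.Limits AlgebraicGeometry TopologicalSpace
open Literature.AlgebraicGeometry.Resolution
open Summit.ResolutionOfSingularities.ResolutionOfSingularities.Theses.WeightedInvariant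

namespace Summit.ResolutionOfSingularities.ResolutionOfSingularities.Cruxes.WeightedThesis.Lines.KunzTower

/-! ## The stubs -/

/-- STUB 1 (existence of F-blowups; Villamayor 2006 3.4 gluing of the affine blow-ups of
Frobenius norm ideals; FBlowup.lean lists it as the follow-up "EXISTENCE"): every integral
separated scheme of finite type over a perfect field of characteristic `p` admits an `e`-th
F-blowup, for every `e`. [cite: Yasuda2012, Def. 2.2 and Cor. 2.6; Villamayoru2006, Thm. 3.3 and 3.4] -/
theorem stub_fblowupExists :
    ∀ (p : ℕ) [Fact p.Prime] (k : Type) [Field k] [CharP k p] [PerfectField k]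
      (X : Scheme.{0}) (f : X ⟶ Spec (.of k)) [IsIntegral X] [IsSeparated f]
      [LocallyOfFiniteType f] [QuasiCompact f] [CharP X.functionField p] (e : ℕ), 0 < e →
      ∃ (Y : Scheme.{0}) (g : Y ⟶ X), IsFBlowup p e g :=
  -- LANDED (p99705)
  Summit.ResolutionOfSingularities.ResolutionOfSingularities.Theorems.WeightedThesis.KunzTower.stub_fblowupExists

/-- STUB 2 (towers exist, with their bookkeeping): if every integral separated `k`-scheme of
finite type (with function field of characteristic `p`) has an `e`-th F-blowup, then over every
such `X₀` there is a normalised F-blowup tower of level `e` — `X : ℕ → Scheme`, `ρ n : X n ⟶ X₀`,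
`π n : X (n+1) ⟶ X n`, `π n ≫ ρ n = ρ (n+1)`, every `X n` integral with function field of
characteristic `p`, `ρ 0` and every `π n` the normalisation of an `e`-th F-blowup (up to an
isomorphism of the source) — all of whose structure maps `ρ n` are proper and birational
(F-blowups are proper and birational, FBlowup.lean; the normalisation of a variety is finite and
birational; so each stage is again separated of finite type over `k` and the recursion continues).
[cite: Yasuda2012, Def. 2.2 and Cor. 2.6] -/
theorem stub_towerExists :
    ∀ (p : ℕ) [Fact p.Prime] (k : Type) [Field k] [CharP k p] [PerfectField k] (e : ℕ), 0 < e →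
      (∀ (X : Scheme.{0}) (f : X ⟶ Spec (.of k)) [IsIntegral X] [IsSeparated f]
          [LocallyOfFiniteType f] [QuasiCompact f] [CharP X.functionField p],
          ∃ (Y : Scheme.{0}) (g : Y ⟶ X), IsFBlowup p e g) →
      ∀ (X₀ : Scheme.{0}) (f : X₀ ⟶ Spec (.of k)) [IsIntegral X₀] [IsSeparated f]
        [LocallyOfFiniteType f] [QuasiCompact f] [CharP X₀.functionField p],
      ∃ (X : ℕ → Scheme.{0}) (_ : ∀ n, IsIntegral (X n)) (_ : ∀ n, CharP (X n).functionField p)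
        (ρ : ∀ n, X n ⟶ X₀) (π : ∀ n, X (n + 1) ⟶ X n),
        (∀ n, π n ≫ ρ n = ρ (n + 1)) ∧
        (∃ (Y : Scheme.{0}) (_ : IsIntegral Y) (g : Y ⟶ X₀) (i : X 0 ≅ normalization Y),
            IsFBlowup p e g ∧ ρ 0 = i.hom ≫ normalizationι Y ≫ g) ∧
        (∀ n, ∃ (Y : Scheme.{0}) (_ : IsIntegral Y) (g : Y ⟶ X n) (i : X (n + 1) ≅ normalization Y),
            IsFBlowup p e g ∧ π n = i.hom ≫ normalizationι Y ≫ g) ∧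
        (∀ n, IsProper (ρ n) ∧ IsBirational (ρ n)) :=
  -- LANDED (p98038)
  Summit.ResolutionOfSingularities.ResolutionOfSingularities.Theorems.WeightedThesis.KunzTower.stub_towerExists

/-- STUB 3 = the NAMED FACT `Kunz1969` in the direction used (Kunz 1969, Thm. 2.1; Stacks 0EC0):
the Frobenius endomorphism of a regular local ring of characteristic `p` is flat. In tree as the
`def Kunz1969 : Prop` (KunzRegularityCriterion.lean, both directions, unproved); this stub is its
`⇒` half and closes either by a proof (Cohen structure theorem + flatness of `κ⟦X⟧` over `κ⟦X^p⟧`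
+ faithfully flat descent along the completion) or by `Kunz1969.flat_frobenius` once `Kunz1969` is
proved — until then the line is CONDITIONAL on this named fact. [cite: Kunz1969, Thm. 2.1] -/
theorem stub_kunzFlat :
    ∀ (p : ℕ) [Fact p.Prime] (R : Type) [CommRing R] [CharP R p] [IsRegularLocalRing R],
      (frobenius R p).Flat :=
  -- LANDED (p98820)
  Summit.ResolutionOfSingularities.ResolutionOfSingularities.Theorems.WeightedThesis.KunzTower.stub_kunzFlat

/-- STUB 4 (Kunz ⇒ F-blowups are isomorphisms over the regular locus; Yasuda 2012 Prop. 2.7 /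
Cor. 2.6 "an isomorphism over `X_sm`"), from the flatness direction of Kunz's criterion taken as a
hypothesis (stub 3): at a regular point `F^e_* 𝒪` is flat and finite (F-finiteness, FFinite.lean),
hence free, so the Frobenius norm ideal is principal near the point and its blow-up is an
isomorphism there. Stated for `e`-th F-blowups of integral schemes locally of finite type over a
perfect field of characteristic `p` and opens `U ⊆ Reg X`.
[cite: Yasuda2012, Prop. 2.7 and Cor. 2.6; Kunz1969, Thm. 2.1] -/
theorem stub_kunzIso :
    (∀ (p : ℕ) [Fact p.Prime] (R : Type) [CommRing R] [CharP R p] [IsRegularLocalRing R],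
        (frobenius R p).Flat) →
    ∀ (p : ℕ) [Fact p.Prime] (k : Type) [Field k] [CharP k p] [PerfectField k] (e : ℕ), 0 < e →
      ∀ (X Y : Scheme.{0}) (f : X ⟶ Spec (.of k)) [IsIntegral X] [LocallyOfFiniteType f]
      [CharP X.functionField p] (g : Y ⟶ X), IsFBlowup p e g →
      ∀ (U : X.Opens), (U : Set X) ⊆ Scheme.regularLocus X → IsIso (g ∣_ U) :=
  -- LANDED (p100239)
  Summit.ResolutionOfSingularities.ResolutionOfSingularities.Theorems.WeightedThesis.KunzTower.stub_kunzIso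

/-- STUB 5 (the normalisation is an isomorphism over regular opens): for an integral scheme
locally of finite type over a field, `normalizationι X` restricts to an isomorphism over every
open `U` contained in the regular locus (regular local rings are integrally closed, so `U` is
normal and the finite birational normalisation is an isomorphism over it). [folklore;
cite: Liu2002, Cor. 4.1.30 and Prop. 4.1.22] -/
theorem stub_normalizationIso :
    ∀ (k : Type) [Field k] (X : Scheme.{0}) (f : X ⟶ Spec (.of k)) [IsIntegral X]
      [LocallyOfFiniteType f] (U : X.Opens), (U : Set X) ⊆ Scheme.regularLocus X →
      IsIso (normalizationι X ∣_ U) :=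
  -- LANDED (p97893)
  Summit.ResolutionOfSingularities.ResolutionOfSingularities.Theorems.WeightedThesis.KunzTower.stub_normalizationIso

/-- STUB 6 (local-to-global termination): let `X : ℕ → Scheme` be a tower over an integral
separated `X₀` of finite type over a field `k`, with proper structure maps `ρ n : X n ⟶ X₀`,
transition maps `π n` with `π n ≫ ρ n = ρ (n+1)` that are isomorphisms over every open inside the
regular locus of `X n`. If over every CLOSED point `x ∈ X₀` some stage `X n` is regular at all
points above `x`, then some `X n` is regular. (The sets `G_n = X₀ ∖ ρ n (Sing X n)` are open —
`ρ n` is closed, `Sing` is closed for schemes locally of finite type over a field —, increase with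
`n` by the isomorphism hypothesis, and cover the closed points, hence all of `X₀` (Jacobson); by
quasi-compactness some `G_N = X₀`.) [folklore] -/
theorem stub_localToGlobal :
    ∀ (k : Type) [Field k] (X₀ : Scheme.{0}) (f : X₀ ⟶ Spec (.of k)) [IsIntegral X₀]
      [IsSeparated f] [LocallyOfFiniteType f] [QuasiCompact f]
      (X : ℕ → Scheme.{0}) (ρ : ∀ n, X n ⟶ X₀) (π : ∀ n, X (n + 1) ⟶ X n),
      (∀ n, π n ≫ ρ n = ρ (n + 1)) → (∀ n, IsProper (ρ n)) →
      (∀ n (U : (X n).Opens), (U : Set (X n)) ⊆ Scheme.regularLocus (X n) → IsIso (π n ∣_ U)) →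
      (∀ x : X₀, IsClosed ({x} : Set X₀) →
          ∃ n, ∀ y : X n, ρ n y = x → y ∈ Scheme.regularLocus (X n)) →
      ∃ n, Scheme.IsRegular (X n) :=
  -- LANDED (p97848)
  Summit.ResolutionOfSingularities.ResolutionOfSingularities.Theorems.WeightedThesis.KunzTower.stub_localToGlobal

/-- STUB 7 — THE OPEN STUB (normalised Yasuda 2012, Question 1.4; the lead's own): for every
integral separated scheme `X₀` of finite type over a perfect field of characteristic `p` there is a
level `e ≥ 1` such that EVERY normalised F-blowup tower of level `e` over `X₀` becomes regular
above each closed point of `X₀` at some stage. Status (2026-08-16): OPEN in every dimension `≥ 2`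
("their behavior is a mystery yet, even in dimension two", Hara–Sawada–Yasuda arXiv:1108.1840
p. 3); PROVED CASES in print: curves (one step: the normalisation; Yasuda Cor. 2.8), rational
surface singularities (the iterated tower reaches the minimal resolution for ANY levels `e_i`,
HSY Cor. 3.3 (2)), F-regular surface germs (one step for `e ≫ 0`, Hara), non-F-pure simple
elliptic `Ẽ₈` (normalised `FB_e` has one `A_{p^e-2}` point, HSY Thm. 4.14 / Rem. 4.15, then
rational), cones with `-E² ≥ 2` not a `p`-power (one step, HSY Prop. 4.19), normal toric
varieties (computations: kit jobs j013243, j014764 — 673/707 towers finished, 0 loops — and the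
CDLL Nash-counterexample cones). No counterexample is known; the first untreated classes are
cusp / minimally elliptic surface germs in characteristic 2, 3 and non-toric germs of dimension
`≥ 3`. [open; cite: Yasuda2012, Question 1.4; HaraSawadaYasuda2011 = arXiv:1108.1840, Cor. 3.3]

RESHAPE (lead c2, cycle 2): split by dimension into STUB 7a (curves: stage `0` of every tower is
already regular — the normalisation of the F-blowup `Y` of a curve is the regular model, Yasuda
Cor. 2.8; tree: `isRegular_normalization_of_dim_le_one`, `IsAlteration.topologicalKrullDim_eq`)
and STUB 7b (the open stub, `1 < dim X₀`); `stub_pointwiseTermination` below is their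
composition (level `e = 1`, stage `n = 0` in the curve case). -/
theorem stub_stageZero_isRegular_of_dim_le_one :
    ∀ (p : ℕ) [Fact p.Prime] (k : Type) [Field k] [CharP k p] [PerfectField k]
      (X₀ : Scheme.{0}) (f : X₀ ⟶ Spec (.of k)) [IsIntegral X₀] [LocallyOfFiniteType f]
      [CharP X₀.functionField p] (e : ℕ) (Z Y : Scheme.{0}) [IsIntegral Y] (g : Y ⟶ X₀)
      (_ : Z ≅ normalization Y), IsFBlowup p e g → topologicalKrullDim X₀ ≤ 1 →
      Scheme.IsRegular Z :=
  -- LANDED (p125818, lead c2 wave 1)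
  Summit.ResolutionOfSingularities.ResolutionOfSingularities.Theorems.WeightedThesis.KunzTower.stub_stageZero_isRegular_of_dim_le_one

/-- STUB 7b — **REFUTED (lead c3, 2026-08-17): this statement is FALSE, the line is DEAD.** Witness:
the normal affine toric sixfold `X₀ = U_{K0}` over `𝔽_p` (certified first at `p = 5`; by the
addendum of the refutation file at EVERY prime `p`), `K0 = cone(e1,…,e6, (0,1,-1,1,0,0),
(-1,-1,1,0,0,1), (-1,0,0,1,1,0)) ⊂ ℤ^6` (totally unimodular): for EVERY `e ≥ 1` the normalised
level-`e` F-blowup tower is singular above the torus-fixed point at every stage, because `K0`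
recurs up to `GL_6(ℤ)` as a maximal chamber three normalised F-blowups down
(`K0 ⊋ K1 ⊋ K2 ⊋ g K0`, certified at levels ∞, 3, 4, 5, 7, 8, 9, plus a one-step loop at level 2
and `A_p = A_∞` for all `p ≥ 11`; `Cruxes/WeightedThesis/Lines/
kunz_tower_exceptional_defect_{dead,refutation_c3,tools_c3}.md`). So normalised iterated F-blowups
(Yasuda's Question 1.4, normalised) do NOT resolve toric varieties of dimension `≥ 6`, at any level
or level sequence; dimensions 3–5 show no loop in an exhaustive census. The `sorry` below can never
be filled; `WeightedThesis_of` is vacuous. ORIGINAL TEXT: the open stub in dimension `≥ 2`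
(normalised Yasuda 2012, Question 1.4): the statement of stub 7 for integral separated `X₀` of
finite type over a perfect field of characteristic `p` with `1 < dim X₀`. Evidence (lead c2, 2026-08-16): for QUASI-HOMOGENEOUS
normal surface germs `R(P¹, D)` the elliptic germs along the tower are `R(P¹, D^{(k)})` with
`D^{(0)} < D^{(1)} < ⋯` strictly increasing coefficientwise on a fixed support (so no periodic
tower exists in this class), `p_g` non-increasing; all of > 600 sampled germs (char 2, 3; levels
1, 2) terminate in ≤ 3 steps (qhtower.py, kit jobs j019905–j019909).
Evidence (lead c3, 2026-08-16/17, `Cruxes/WeightedThesis/` evidence `stub7b-evidence-c3.md`):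
TORIC VARIETIES, LEVEL-UNIFORMLY. For an affine normal toric `U_τ` the normalised level-`q`
F-blowup is the Gröbner fan `Δ_q(τ)` (CMDY arXiv:2304.13247 Prop. 2.13), the common refinement of
the normal fans of `conv(M ∩ (τ^∨ − c))`, `c ∈ (1/q)M`; these depend only on the class
`⌊Vc⌋ mod V M`, every class is attained on an open set of `c`, so `Δ_q(τ) ≼ Δ_∞(τ)` (refinement
over all `c ∈ M_ℝ`) with EQUALITY for `q ≥ q₀(τ)`. Hence (i) a type-loop (up to `GL_n(ℤ)`) of the
level-∞ tower `T_∞` refutes this stub for every `e` at once (`U_τ ⊗ 𝔽_p`, `p ≥ Q₀`), and (ii) if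
`T_∞` terminates on every cone the stub HOLDS for all normal toric varieties (every `p`,
`e ≥ e₀`). Exact engine (stdlib Python, validated against Yasuda Thm 1.7(3), Nakamura/Craw–Reid
crepant `G`-Hilb counts, Sato–Sato's `Fan(1/9(1,4,7))` = 21 cones, CMDY Ex. 6.16, products, and the
triage's independent CDLL numbers): NO LOOP — dim 3: for all 2300 `1/r(1,a,b)`, `r ≤ 24`, and all
224 `GL_3(ℤ)`-types of 3-cones with all minors `≤ 5`, `Δ_∞` has ONLY unimodular and conifold
chambers, so `T_∞` stops after ≤ 2 steps (conjecturally for every toric 3-fold); dim 4: all 715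
`1/r(1,a,b,c)`, `r ≤ 11`, stop with depth ≤ 4 through a zoo of 13 child types, all 64 types with
minors `≤ 2` stop; dim 5: all 18 totally unimodular types and `1/r`, `r ≤ 7`, stop, but the
max-minor of chambers can GROW there (an 8-ray unimodular cone has a 10-ray chamber with minor 3),
so dimension ≥ 5 is where a toric loop could still live; CDLL's Nash-loop cones stop at all levels.
[open; cite: Yasuda2012, Question 1.4 and Thm. 1.7; HaraSawadaYasuda2011 = arXiv:1108.1840, Cor. 3.3;
ChavezMartinezDuarteYasuda2023 = arXiv:2304.13247, Prop. 2.13] -/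
theorem stub_pointwiseTermination_of_one_lt_dim :
    ∀ (p : ℕ) [Fact p.Prime] (k : Type) [Field k] [CharP k p] [PerfectField k]
      (X₀ : Scheme.{0}) (f : X₀ ⟶ Spec (.of k)) [IsIntegral X₀] [IsSeparated f]
      [LocallyOfFiniteType f] [QuasiCompact f] [CharP X₀.functionField p],
      1 < topologicalKrullDim X₀ →
      ∃ e : ℕ, 0 < e ∧
        ∀ (X : ℕ → Scheme.{0}) [∀ n, IsIntegral (X n)] [∀ n, CharP (X n).functionField p]
          (ρ : ∀ n, X n ⟶ X₀) (π : ∀ n, X (n + 1) ⟶ X n),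
          (∀ n, π n ≫ ρ n = ρ (n + 1)) →
          (∃ (Y : Scheme.{0}) (_ : IsIntegral Y) (g : Y ⟶ X₀) (i : X 0 ≅ normalization Y),
              IsFBlowup p e g ∧ ρ 0 = i.hom ≫ normalizationι Y ≫ g) →
          (∀ n, ∃ (Y : Scheme.{0}) (_ : IsIntegral Y) (g : Y ⟶ X n)
              (i : X (n + 1) ≅ normalization Y),
              IsFBlowup p e g ∧ π n = i.hom ≫ normalizationι Y ≫ g) →
          ∀ x : X₀, IsClosed ({x} : Set X₀) →
            ∃ n, ∀ y : X n, ρ n y = x → y ∈ Scheme.regularLocus (X n) := by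
  sorry

/-- STUB 7 (normalised Yasuda 2012, Question 1.4) as the COMPOSITION of stubs 7a and 7b: in
dimension `≤ 1` take level `e = 1` and stage `n = 0` (stub 7a: the first stage is regular);
otherwise stub 7b. [cite: Yasuda2012, Question 1.4 and Cor. 2.8] -/
theorem stub_pointwiseTermination :
    ∀ (p : ℕ) [Fact p.Prime] (k : Type) [Field k] [CharP k p] [PerfectField k]
      (X₀ : Scheme.{0}) (f : X₀ ⟶ Spec (.of k)) [IsIntegral X₀] [IsSeparated f]
      [LocallyOfFiniteType f] [QuasiCompact f] [CharP X₀.functionField p],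
      ∃ e : ℕ, 0 < e ∧
        ∀ (X : ℕ → Scheme.{0}) [∀ n, IsIntegral (X n)] [∀ n, CharP (X n).functionField p]
          (ρ : ∀ n, X n ⟶ X₀) (π : ∀ n, X (n + 1) ⟶ X n),
          (∀ n, π n ≫ ρ n = ρ (n + 1)) →
          (∃ (Y : Scheme.{0}) (_ : IsIntegral Y) (g : Y ⟶ X₀) (i : X 0 ≅ normalization Y),
              IsFBlowup p e g ∧ ρ 0 = i.hom ≫ normalizationι Y ≫ g) →
          (∀ n, ∃ (Y : Scheme.{0}) (_ : IsIntegral Y) (g : Y ⟶ X n)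
              (i : X (n + 1) ≅ normalization Y),
              IsFBlowup p e g ∧ π n = i.hom ≫ normalizationι Y ≫ g) →
          ∀ x : X₀, IsClosed ({x} : Set X₀) →
            ∃ n, ∀ y : X n, ρ n y = x → y ∈ Scheme.regularLocus (X n) := by
  intro p _ k _ _ _ X₀ f _ _ _ _ _
  by_cases hdim : topologicalKrullDim X₀ ≤ 1
  · refine ⟨1, one_pos, ?_⟩
    intro X _ _ ρ π _ h0 _ x _
    refine ⟨0, fun y _ => ?_⟩
    obtain ⟨Y, hY, g, i, hg, -⟩ := h0
    exact stub_stageZero_isRegular_of_dim_le_one p k X₀ f 1 (X 0) Y g i hg hdim y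
  · exact stub_pointwiseTermination_of_one_lt_dim p k X₀ f (not_le.mp hdim)

/-! ## Composition -/

/-- The function field of an integral scheme over a field of characteristic `p` has
characteristic `p` (the structure map `k → K(X)` is a ring homomorphism of fields). [folklore] -/
theorem charP_functionField_of_over {k : Type} [Field k] (p : ℕ) [CharP k p] {X : Scheme.{0}}
    [IsIntegral X] (f : X ⟶ Spec (.of k)) : CharP X.functionField p := by
  haveI : Nonempty (⊤ : X.Opens) := by
    obtain ⟨x⟩ := (inferInstance : Nonempty X)
    exact ⟨⟨x, trivial⟩⟩
  let φ : k →+* X.functionField :=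
    (X.germToFunctionField ⊤).hom.comp
      ((f.appTop).hom.comp (Scheme.ΓSpecIso (.of k)).commRingCatIsoToRingEquiv.symm.toRingHom)
  exact (RingHom.charP_iff_charP φ p).mp ‹_›

/-- The step maps of a normalised F-blowup tower are isomorphisms over regular opens, from
stubs 4 and 5: over `U ⊆ Reg (X n)` the F-blowup `g` is an isomorphism (Kunz), so `g⁻¹ U ≅ U` is
regular and the normalisation is an isomorphism over it. [cite: Yasuda2012, Cor. 2.6] -/
theorem isIso_step_restrict {p : ℕ} [Fact p.Prime] {k : Type} [Field k] [CharP k p]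
    [PerfectField k] {e : ℕ} (he : 0 < e) {W Z : Scheme.{0}} (fW : W ⟶ Spec (.of k)) [IsIntegral W]
    [LocallyOfFiniteType fW] [CharP W.functionField p] (π : Z ⟶ W)
    (h : ∃ (Y : Scheme.{0}) (_ : IsIntegral Y) (g : Y ⟶ W) (i : Z ≅ normalization Y),
      IsFBlowup p e g ∧ π = i.hom ≫ normalizationι Y ≫ g)
    (U : W.Opens) (hU : (U : Set W) ⊆ Scheme.regularLocus W) : IsIso (π ∣_ U) := by
  obtain ⟨Y, hY, g, i, hg, rfl⟩ := h
  -- the isomorphism factor first (before heavier `IsIso` facts enter the local context)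
  have h1 : IsIso (i.hom ∣_ (normalizationι Y ≫ g) ⁻¹ᵁ U) := inferInstance
  -- the F-blowup is an isomorphism over `U` (stubs 3 + 4)
  have hgU : IsIso (g ∣_ U) :=
    stub_kunzIso (fun p _ R _ _ _ => stub_kunzFlat p R) p k e he W Y fW g hg U hU
  -- `Y` is locally of finite type over `k` (the F-blowup is proper)
  haveI : IsLocallyNoetherian W := LocallyOfFiniteType.isLocallyNoetherian fW
  haveI : IsProper g := hg.isProper
  haveI : LocallyOfFiniteType (g ≫ fW) := inferInstance
  -- `g ⁻¹ U` lies in the regular locus of `Y`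
  have hV : ((g ⁻¹ᵁ U : Y.Opens) : Set Y) ⊆ Scheme.regularLocus Y := by
    intro y hy
    exact (@mem_regularLocus_iff_of_isIso_morphismRestrict _ _ g U hgU y hy).mpr (hU hy)
  -- the normalisation is an isomorphism over it (stub 5)
  have hνV : IsIso (normalizationι Y ∣_ g ⁻¹ᵁ U) :=
    stub_normalizationIso k Y (g ≫ fW) (g ⁻¹ᵁ U) hV
  -- assemble
  rw [morphismRestrict_comp, morphismRestrict_comp]
  exact @IsIso.comp_isIso _ _ _ _ _ _ _ h1 (@IsIso.comp_isIso _ _ _ _ _ _ _ hνV hgU)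

/-- STUB 8 = THE TRANSFER THEOREM of the line (C⁺ ⇒ crux) — LANDED (p105990,
`Theorems/WeightedInvariantWeightedThesisKunzTowerTransfer.lean`; its proof is the composition
written out below): pointwise termination of the normalised F-blowup tower (the statement of stub 7,
verbatim) ⇒ `WeightedThesis`. [cite: Yasuda2012, Question 1.4 and Cor. 2.6] -/
theorem stub_weightedThesis_of_pointwiseTermination :
    (∀ (p : ℕ) [Fact p.Prime] (k : Type) [Field k] [CharP k p] [PerfectField k]
      (X₀ : Scheme.{0}) (f : X₀ ⟶ Spec (.of k)) [IsIntegral X₀] [IsSeparated f]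
      [LocallyOfFiniteType f] [QuasiCompact f] [CharP X₀.functionField p],
      ∃ e : ℕ, 0 < e ∧
        ∀ (X : ℕ → Scheme.{0}) [∀ n, IsIntegral (X n)] [∀ n, CharP (X n).functionField p]
          (ρ : ∀ n, X n ⟶ X₀) (π : ∀ n, X (n + 1) ⟶ X n),
          (∀ n, π n ≫ ρ n = ρ (n + 1)) →
          (∃ (Y : Scheme.{0}) (_ : IsIntegral Y) (g : Y ⟶ X₀) (i : X 0 ≅ normalization Y),
              IsFBlowup p e g ∧ ρ 0 = i.hom ≫ normalizationι Y ≫ g) →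
          (∀ n, ∃ (Y : Scheme.{0}) (_ : IsIntegral Y) (g : Y ⟶ X n)
              (i : X (n + 1) ≅ normalization Y),
              IsFBlowup p e g ∧ π n = i.hom ≫ normalizationι Y ≫ g) →
          ∀ x : X₀, IsClosed ({x} : Set X₀) →
            ∃ n, ∀ y : X n, ρ n y = x → y ∈ Scheme.regularLocus (X n)) →
    WeightedThesis :=
  -- LANDED (p105990)
  Summit.ResolutionOfSingularities.ResolutionOfSingularities.Theorems.WeightedThesis.KunzTower.stub_weightedThesis_of_pointwiseTermination

/-- **The composition, written out** (this is the proof that lands as stub 8): integral case — take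
the level `e` of the termination hypothesis, a tower of level `e` with proper birational stages
(stubs 1–2), its pointwise termination, globalise (stub 6, fed by stubs 3–5 through
`isIso_step_restrict`), and descend the resolution of the regular stage along the proper birational
`ρ n`; reduced case — `DescentReducedToIntegral` (landed, stmt-0551).
[cite: Yasuda2012, Question 1.4 and Cor. 2.6] -/
theorem weightedThesis_of_pointwiseTermination_proof
    (hPT : ∀ (p : ℕ) [Fact p.Prime] (k : Type) [Field k] [CharP k p] [PerfectField k]
      (X₀ : Scheme.{0}) (f : X₀ ⟶ Spec (.of k)) [IsIntegral X₀] [IsSeparated f]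
      [LocallyOfFiniteType f] [QuasiCompact f] [CharP X₀.functionField p],
      ∃ e : ℕ, 0 < e ∧
        ∀ (X : ℕ → Scheme.{0}) [∀ n, IsIntegral (X n)] [∀ n, CharP (X n).functionField p]
          (ρ : ∀ n, X n ⟶ X₀) (π : ∀ n, X (n + 1) ⟶ X n),
          (∀ n, π n ≫ ρ n = ρ (n + 1)) →
          (∃ (Y : Scheme.{0}) (_ : IsIntegral Y) (g : Y ⟶ X₀) (i : X 0 ≅ normalization Y),
              IsFBlowup p e g ∧ ρ 0 = i.hom ≫ normalizationι Y ≫ g) →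
          (∀ n, ∃ (Y : Scheme.{0}) (_ : IsIntegral Y) (g : Y ⟶ X n)
              (i : X (n + 1) ≅ normalization Y),
              IsFBlowup p e g ∧ π n = i.hom ≫ normalizationι Y ≫ g) →
          ∀ x : X₀, IsClosed ({x} : Set X₀) →
            ∃ n, ∀ y : X n, ρ n y = x → y ∈ Scheme.regularLocus (X n)) :
    WeightedThesis := by
  intro p hp k _ _ _ X f hsep hlft hqc hred
  haveI : Fact p.Prime := ⟨hp⟩
  refine Summit.ResolutionOfSingularities.ResolutionOfSingularities.Theorems.descentReducedToIntegral_proof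
    k (fun X₀ f₀ hsep₀ hlft₀ hqc₀ hint₀ => ?_) X f hsep hlft hqc hred
  haveI := hsep₀; haveI := hlft₀; haveI := hqc₀; haveI := hint₀
  haveI : CharP X₀.functionField p := charP_functionField_of_over p f₀
  -- the level and the tower
  obtain ⟨e, he, hterm⟩ := hPT p k X₀ f₀
  obtain ⟨T, hTint, hTchar, ρ, π, hρ, h0, hstep, hstage⟩ :=
    stub_towerExists p k e he (fun X f _ _ _ _ _ => stub_fblowupExists p k X f e he) X₀ f₀
  -- steps are isomorphisms over regular opens
  have hiso : ∀ n (U : (T n).Opens), (U : Set (T n)) ⊆ Scheme.regularLocus (T n) →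
      IsIso (π n ∣_ U) := by
    intro n U hU
    haveI : IsProper (ρ n) := (hstage n).1
    haveI : LocallyOfFiniteType (ρ n ≫ f₀) := inferInstance
    exact isIso_step_restrict he (ρ n ≫ f₀) (π n) (hstep n) U hU
  -- globalise the pointwise termination
  obtain ⟨n, hn⟩ := stub_localToGlobal k X₀ f₀ T ρ π hρ (fun n => (hstage n).1) hiso
    (hterm T ρ π hρ h0 hstep)
  -- descend the resolution along `ρ n`
  haveI : IsProper (ρ n) := (hstage n).1
  exact Scheme.HasResolution.of_isBirational (ρ n) (hstage n).2 hn.hasResolution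

/-- **The line closes the crux modulo its stubs: `WeightedThesis` BY NAME** — the transfer (stub 8)
applied to pointwise termination (stub 7, OPEN). [cite: Yasuda2012, Question 1.4 and Cor. 2.6] -/
theorem WeightedThesis_of : WeightedThesis :=
  stub_weightedThesis_of_pointwiseTermination (fun p _ k _ _ _ X₀ f _ _ _ _ _ =>
    stub_pointwiseTermination p k X₀ f)

end Summit.ResolutionOfSingularities.ResolutionOfSingularities.Cruxes.WeightedThesis.Lines.KunzTower

end
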